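import Literature.NumberTheory.EllipticCurves.PadicSigmaOddPrime
import Literature.NumberTheory.EllipticCurves.PadicSigmaVariableChangeProofs
import Literature.NumberTheory.EllipticCurves.PadicFormalLogOrder
import HarnessLib

/-!
# X1 bookkeeping: the binder `mazur_tate_sigma_exists_odd` (registry A34) reduced to ONE local
# statement at `p = 3` — a Mazur–Tate pair for every `3`-integral model `y² = x³ + a₂x² + a₄x + a₆`
# over `ℚ₃` with unit discriminant and unit Hasse coefficient

HONEST FRAMING (cell `b2b-bsdres`, run/shared/lean/b2b/bsd-rank1-residual/, verbatim in every
file): the goal of the cell is to DELETE the COMBINATION-SHAPED residual classes of the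
Birch–Swinnerton-Dyer formula for ALL analytic-rank `≤ 1` elliptic curves over `ℚ` — "full BSD
formula for every rank `≤ 1` curve in class `C`" assembled STRICTLY from published theorems — so
that the rank-`≤ 1` remainder becomes exactly the CONSTRUCTION-SHAPED classes, which are TYPED
(missing-input `Prop`s), NOT attempted. This is not "finishing BSD". CLASS-OWNERS.md: row
"X1 (r = 1)" — research route; NO CLAIM BEYOND STATED CLASSES; no label change; nothing is booked by
this file; no preprint enters; NO definition, NO named fact; nothing is discharged here.

Unit `b2b-bsdres-x1a` (X1 prover A, gen 19). WHY. Every rank-one record of the cell at `p = 3`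
(8 668 of the 9 199 rows of the lane offer `class-closure/N1/OFFER-T-X1R1-RP1-x1a.md`, and x1b's /
eisenstein's `p = 3` records) carries the binder `hMT : mazur_tate_sigma_exists_odd` (x1b gen 4,
`PadicSigmaOddPrime.lean`): existence of the Mazur–Tate pair `(σ, c)` at every odd good ordinary
prime. Its content beyond the tree is the single prime `p = 3`
(`mazur_tate_sigma_exists_odd_iff_three`; `p ≥ 5` is the tree THEOREM
`mazur_tate_sigma_existsUnique_holds`, Blakestad–Grant 2023). The tree's `p ≥ 5` proof is
structurally `p > 3`: it runs through the universal SHORT Weierstrass curve (`toShortNF`,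
`r = -b₂/12`), whose ordinary locus is empty modulo `3`. WHAT. This file performs, at `p = 3`, the
one step of that proof that does survive — the transport to a normal form — with the normal form
that is available at `3`: Mathlib's `toCharNeTwoNF` (`u = 1`, `r = 0`, `s = -a₁/2`, `t = -a₃/2`;
`2 ∈ ℤ₃ˣ`) carries `W ⊗ ℚ₃` to a `3`-integral model `y² = x³ + a₂x² + a₄x + a₆` with the same
discriminant and a unit Hasse coefficient (`norm_coeff_formalOmega_variableChange_eq_one`), and a
Mazur–Tate pair transports back (`exists_isMazurTateSigmaPair_of_variableChange`). Hence
(`mazur_tate_sigma_exists_odd_of_exists_charNeTwoNF_three`): **A34 follows from the purely local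
statement "every `3`-integral `V : y² = x³ + a₂x² + a₄x + a₆` over `ℚ₃` with `‖Δ‖₃ = 1` and
`‖c₂‖₃ = 1` (`ω = Σ cₙ zⁿ dz`; `c₂ = a₂` here, the Hasse invariant at `3`) has a Mazur–Tate pair"**
— the exact target a `p = 3` universal-sigma-function construction (Blakestad–Grant's method with
the `a₂`-family, kernel polynomial of degree `n = 1`) would have to hit; see
HOME/b2b-bsdres-x1a/X1-CHAIN.md §28e for the road-map and its size. Nothing else is claimed.

References: [MazurSteinTate2006] Thm. 1.3; [Balakrishnan2016] §2 eq. (2.3); [BlakestadGrant2023]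
Thm. 1 ("Let p > 3 be prime"); [SilvermanAEC2009] III.1, VII.1.
-/

noncomputable section

open scoped Classical

open PowerSeries WeierstrassCurve Literature.NumberTheory.EllipticCurves

set_option autoImplicit false

namespace Summit.BirchSwinnertonDyer.Rank1Residual.X1

/-- **Mathlib's `toCharNeTwoNF` is `p`-integral at every odd `p`** for a `p`-integral equation:
`u = 1`, `r = 0`, `s = -a₁/2`, `t = -a₃/2` with `2 ∈ ℤ_pˣ`. (The `p ≥ 5` file proves this inside
`norm_toShortNF_le`; here it is isolated for `p = 3`.) [cite: SilvermanAEC2009, III.1] -/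
theorem norm_toCharNeTwoNF_le {p : ℕ} [Fact p.Prime] (hp : 3 ≤ p) (V : WeierstrassCurve ℚ_[p])
    [V.IsIntegral ℤ_[p]] :
    ‖(V.toCharNeTwoNF.u : ℚ_[p])‖ = 1 ∧ ‖V.toCharNeTwoNF.r‖ ≤ 1 ∧ ‖V.toCharNeTwoNF.s‖ ≤ 1 ∧
      ‖V.toCharNeTwoNF.t‖ ≤ 1 := by
  obtain ⟨h₁, -, h₃, -, -⟩ := V.coeffs_mem_subring
  have h2 : (⅟(2 : ℚ_[p])) ∈ PadicInt.subring p := by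
    have := invOf_natCast_mem_subring (p := p) 2 (by norm_num) (by omega)
    simpa using this
  refine ⟨by rw [toCharNeTwoNF_u, Units.val_one, norm_one],
    by rw [toCharNeTwoNF_r, norm_zero]; exact zero_le_one, ?_, ?_⟩
  · rw [toCharNeTwoNF_s, ← PadicInt.mem_subring_iff]; exact mul_mem h2 (neg_mem h₁)
  · rw [toCharNeTwoNF_t, ← PadicInt.mem_subring_iff]; exact mul_mem h2 (neg_mem h₃)

/-- **A34 (`mazur_tate_sigma_exists_odd`) ⇐ a Mazur–Tate pair for every `3`-integral model
`y² = x³ + a₂x² + a₄x + a₆` over `ℚ₃` with unit discriminant and unit Hasse coefficient `c₂`.**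
For `W/ℚ` globally minimal with good ordinary reduction at `3`, `V := toCharNeTwoNF • (W ⊗ ℚ₃)` is
such a model (`‖Δ_V‖ = ‖Δ_W‖ = 1` by good reduction, `‖c₂(V)‖ = ‖c₂(W)‖ = 1` by ordinarity and
`norm_coeff_formalOmega_variableChange_eq_one`), a pair of `V` transports back to `W ⊗ ℚ₃`
(`exists_isMazurTateSigmaPair_of_variableChange`), and every odd `p ≥ 5` is the tree's theorem
(`mazur_tate_sigma_exists_odd_iff_three`). Reduction only — the local statement is NOT proved here.
[cite: MazurSteinTate2006, Thm. 1.3] [cite: Balakrishnan2016, §2 eq. (2.3)]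
[cite: SilvermanAEC2009, VII.1 Prop. 1.3] -/
theorem mazur_tate_sigma_exists_odd_of_exists_charNeTwoNF_three
    (hex : ∀ (V : WeierstrassCurve ℚ_[3]) [V.IsIntegral ℤ_[3]] [V.IsCharNeTwoNF],
      ‖V.Δ‖ = 1 → ‖coeff 2 V.formalOmega‖ = 1 →
        ∃ σ : ℚ_[3]⟦X⟧, ∃ c : ℚ_[3], V.IsMazurTateSigmaPair σ c) :
    mazur_tate_sigma_exists_odd := by
  refine mazur_tate_sigma_exists_odd_iff_three.mpr fun W _ _ _ hgood hord ↦ ?_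
  set V₀ := W.baseChange ℚ_[3] with hV₀
  have hn := norm_toCharNeTwoNF_le (p := 3) le_rfl V₀
  haveI := V₀.isIntegral_variableChange V₀.toCharNeTwoNF hn.1 hn.2.1 hn.2.2.1 hn.2.2.2
  have hΔ : ‖(V₀.toCharNeTwoNF • V₀).Δ‖ = 1 := by
    rw [variableChange_Δ, toCharNeTwoNF_u, inv_one, Units.val_one, one_pow, one_mul]
    exact norm_Δ_baseChange_eq_one_of_hasGoodReductionAtPrime W 3 hgood
  have hc : ‖coeff (3 - 1) V₀.formalOmega‖ = 1 := by
    have h := norm_coeff_formalOmega_eq_one_of_good_ordinary W 3 (by decide) hgood hord 0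
    rwa [zero_add, pow_one] at h
  have hc' := V₀.norm_coeff_formalOmega_variableChange_eq_one V₀.toCharNeTwoNF hn.1 hn.2.1
    hn.2.2.1 hn.2.2.2 hc
  exact exists_isMazurTateSigmaPair_of_variableChange hn.1 hn.2.1 hn.2.2.1 hn.2.2.2
    (hex _ hΔ hc')

/-- **And A34 gives the local statement back on the models that arise from global curves**: for
`W/ℚ` globally minimal with good ordinary reduction at `3`, the model `toCharNeTwoNF • (W ⊗ ℚ₃)`
has a Mazur–Tate pair (transport forward along the inverse change, again `3`-integral with
`u = 1`). Bookkeeping only. [cite: MazurSteinTate2006, Thm. 1.3] -/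
theorem exists_isMazurTateSigmaPair_toCharNeTwoNF_three (hMT : mazur_tate_sigma_exists_odd)
    (W : WeierstrassCurve ℚ) [W.IsElliptic] [W.IsGloballyMinimal] [Fact (3 : ℕ).Prime]
    (hgood : W.HasGoodReductionAtPrime 3) (hord : ¬ ((3 : ℕ) : ℤ) ∣ W.frobeniusTrace 3) :
    ∃ σ : ℚ_[3]⟦X⟧, ∃ c : ℚ_[3],
      ((W.baseChange ℚ_[3]).toCharNeTwoNF • W.baseChange ℚ_[3]).IsMazurTateSigmaPair σ c := by
  set V₀ := W.baseChange ℚ_[3] with hV₀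
  set vc := V₀.toCharNeTwoNF with hvc
  have hn := norm_toCharNeTwoNF_le (p := 3) le_rfl V₀
  haveI := V₀.isIntegral_variableChange vc hn.1 hn.2.1 hn.2.2.1 hn.2.2.2
  -- the inverse change `vc⁻¹` is again integral with `u = 1`, and `vc⁻¹ • (vc • V₀) = V₀`
  have hu' : ‖((vc⁻¹).u : ℚ_[3])‖ = 1 := by
    rw [hvc, VariableChange.inv_def]; simp
  have hr' : ‖(vc⁻¹).r‖ ≤ 1 := by
    rw [hvc, VariableChange.inv_def]; simp
  have hs' : ‖(vc⁻¹).s‖ ≤ 1 := by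
    have h := hn.2.2.1
    rw [hvc, VariableChange.inv_def]
    simpa [toCharNeTwoNF_u] using h
  have ht' : ‖(vc⁻¹).t‖ ≤ 1 := by
    have h := hn.2.2.2
    rw [hvc, VariableChange.inv_def]
    simpa [toCharNeTwoNF_u, toCharNeTwoNF_r] using h
  refine exists_isMazurTateSigmaPair_of_variableChange hu' hr' hs' ht' ?_
  rw [← mul_smul, inv_mul_cancel, one_smul]
  exact hMT W 3 (by decide) hgood hord

end Summit.BirchSwinnertonDyer.Rank1Residual.X1

end
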